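import Literature.NumberTheory.EllipticCurves.ComplexMultiplicationDeuringHoldsProofs
import Literature.NumberTheory.EllipticCurves.ComplexMultiplicationDeuringRamified1728KProofs
import Literature.NumberTheory.EllipticCurves.ComplexMultiplicationHasCMIffProofs
import Literature.NumberTheory.EllipticCurves.ComplexMultiplicationNotSemistable
import Literature.NumberTheory.EllipticCurves.QuadraticTwistRamifiedLocalPolynomialProofs
import Literature.NumberTheory.EllipticCurves.RootNumberTwistProofs
import Literature.NumberTheory.EllipticCurves.CMNewformOfHeckeCharacterProofs
import Literature.NumberTheory.EllipticCurves.HasseWeilAbelianBadReduction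
import Literature.NumberTheory.GaloisRepresentations.DegreeOnePlacesProofs
import HarnessLib

set_option linter.dupNamespace false -- `Summit.BirchSwinnertonDyer.BirchSwinnertonDyer.Theorems.…` (summit = sub)
set_option autoImplicit false

/-!
# BED route, «Deuring-ψ lane», FILE L (local facts): for a CM curve `E/ℚ` (maximal order) and its CM field `K`,
# good primes are unramified in `K` and bad primes stay bad at every place of `K` above them

Route `BiquadraticEisensteinDescent` of `Summits/BirchSwinnertonDyer` (crux `EisensteinHeartFlatCMInertBadKPrime`,
stmt-BirchSwinnertonDyer-21341; cell `bsd-wall`, width seat `bsd-wall-cm-bed-w4` g17). THEOREMS ONLY. These are the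
two local facts behind clause (iii) «`ψ` is unramified at `w` iff `E_K` has good reduction at `w`» of the named fact
`Deuring_exists_heckeCharacter_of_maximalCM` (Silverman, *Advanced Topics*, II Thm. 9.2 (b)), proved here WITHOUT the
character from two theorems of the tree's Grössencharacter-free Deuring cluster:

* §1 algebra of Mathlib's local Euler factors: `L_w(X)⁻¹ = ofPowerSeries (N w) (1/L_w(X, T))`, `ofPowerSeries` is
  injective, so `L_w⁻¹ = 1` forces `L_w(T) = 1`, i.e. additive (not good) reduction;
* §2 `not_dvd_discr_of_hasGoodReductionAtPrime` (Ex. 2.31 (a): a good prime is unramified in `K`) from the ramified leaf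
  `Deuring_localEulerFactor_ramified` (`L_p(E)⁻¹ = 1` under a place of ramification index `2`);
  `not_hasGoodReductionAt_baseChange_of_bad` (a bad `p` is bad at every `w ∣ p` over `K`) from the PROVED prime-by-prime
  identity `Deuring_localEulerFactor_baseChange_cmField_holds`: `∏_{w ∣ p} L_w(E_K)⁻¹ = (L_p(E)⁻¹)² = 1`, one place
  `⇒ L_w⁻¹ = 1`, two places `⇒ L_{w₁}(T) L_{w₂}(T) = 1` in `ℤ[T]` `⇒` both `1`.

Consumed by `BiquadraticEisensteinDescentDeuringOfCore` (the five clauses from the core). Nothing about BSD is proved.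

References: [SilvermanATAEC1994] II Thm. 9.2 (b), Thm. 10.5, Ex. 2.30–2.32; [SilvermanAEC2009] VII.5 Prop. 5.1, C.16;
[NeukirchANT1999] I (8.2), (9.2).
-/

noncomputable section

open scoped Classical NumberField
open NumberField IsDedekindDomain WeierstrassCurve Polynomial ArithmeticFunction Rat.HeightOneSpectrum
  Literature.NumberTheory.GaloisRepresentations
  Literature.NumberTheory.EllipticCurves
  Literature.NumberTheory.EllipticCurves.ModularForms
  Literature.NumberTheory.Automorphic

namespace Summit.BirchSwinnertonDyer.BirchSwinnertonDyer.Theorems.BiquadraticEisensteinDescentDeuringOfCore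

/-! ## §1 Algebra of local Euler factors: `L_w(E)⁻¹ = 1` as a Dirichlet series forces `L_w(E, T) = 1` -/

section LocalFactor

/-- `ArithmeticFunction.ofPowerSeries q` is injective for `q > 1` (its value at `q^k` is the `k`-th coefficient).
[folklore] -/
theorem ofPowerSeries_injective {R : Type*} [CommSemiring R] {q : ℕ} (hq : 1 < q) :
    Function.Injective (ArithmeticFunction.ofPowerSeries (R := R) q) := by
  intro f g h
  ext k
  have := congrArg (fun F : ArithmeticFunction R ↦ F (q ^ k)) h
  simpa only [ArithmeticFunction.ofPowerSeries_apply_pow hq] using this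

/-- A polynomial with constant coefficient `1` whose formal inverse is `1` is `1`. [folklore] -/
theorem polynomial_eq_one_of_invOfUnit_eq_one (P : ℤ[X]) (h0 : P.coeff 0 = 1)
    (h : PowerSeries.invOfUnit (P : PowerSeries ℤ) 1 = 1) : P = 1 := by
  have hmul := PowerSeries.mul_invOfUnit (P : PowerSeries ℤ) 1 (by
    rw [← PowerSeries.coeff_zero_eq_constantCoeff_apply, Polynomial.coeff_coe, h0, Units.val_one])
  rw [h, mul_one] at hmul
  exact Polynomial.coe_injective ℤ (hmul.trans Polynomial.coe_one.symm)

/-- A product of two polynomials over `ℤ` with constant coefficients `1` is `1` only if the first is `1`. [folklore] -/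
theorem polynomial_eq_one_of_mul_eq_one {P Q : ℤ[X]} (hP : P.coeff 0 = 1) (h : P * Q = 1) : P = 1 := by
  have hu : IsUnit P := IsUnit.of_mul_eq_one Q h
  obtain ⟨r, hr, hrP⟩ := Polynomial.isUnit_iff.mp hu
  rw [← hrP, Polynomial.coeff_C_zero] at hP
  rw [← hrP, hP, map_one]

variable {F : Type*} [Field F] [NumberField F]

/-- **`L_w(X)⁻¹ = 1` as a formal Dirichlet series forces the local polynomial `L_w(X, T) = 1`**
(`L_w⁻¹ = ofPowerSeries (N w) (1/L_w(T))`, `ofPowerSeries` injective, `L_w(0) = 1`). [cite: SilvermanAEC2009, App. C §16 (the local factors)] -/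
theorem localPolynomialAt_eq_one_of_localEulerFactor_eq_one (X : WeierstrassCurve F) (w : HeightOneSpectrum (𝓞 F))
    (h : (X.baseChange (w.adicCompletion F)).localEulerFactor (w.adicCompletionIntegers F) = 1) :
    X.localPolynomialAt w = 1 := by
  rw [X.localEulerFactor_baseChange_adicCompletion w] at h
  have h1 : PowerSeries.invOfUnit (X.localPolynomialAt w : PowerSeries ℤ) 1 = 1 :=
    ofPowerSeries_injective w.one_lt_residueCard (by rw [h, map_one])
  exact polynomial_eq_one_of_invOfUnit_eq_one _ (X.coeff_zero_localPolynomialAt w) h1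

/-- **`L_w(X, T) = 1` means additive, in particular NOT good, reduction at `w`** (at good reduction the local
polynomial is `1 − a_w T + q_w T²` with `q_w ≥ 2`). [cite: SilvermanAEC2009, App. C §16 and VII.5 Prop. 5.1] -/
theorem not_hasGoodReductionAt_of_localPolynomialAt_eq_one (X : WeierstrassCurve F) (w : HeightOneSpectrum (𝓞 F))
    (h : X.localPolynomialAt w = 1) : ¬ X.HasGoodReductionAt w := by
  intro hg
  have h2 := congrArg (fun P : ℤ[X] ↦ P.coeff 2) h
  simp only [localPolynomialAt_of_hasGoodReductionAt hg, coeff_add, coeff_sub, coeff_one, coeff_C_mul, coeff_X,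
    coeff_X_pow] at h2
  norm_num at h2
  have hq := IsDedekindDomain.HeightOneSpectrum.one_lt_residueCard w
  rw [← natCard_residueField_eq_residueCard w] at hq
  omega

/-- `L_w(X)⁻¹ = 1` forces bad reduction at `w`. [cite: SilvermanAEC2009, App. C §16 and VII.5 Prop. 5.1] -/
theorem not_hasGoodReductionAt_of_localEulerFactor_eq_one (X : WeierstrassCurve F) (w : HeightOneSpectrum (𝓞 F))
    (h : (X.baseChange (w.adicCompletion F)).localEulerFactor (w.adicCompletionIntegers F) = 1) :
    ¬ X.HasGoodReductionAt w :=
  not_hasGoodReductionAt_of_localPolynomialAt_eq_one X w (localPolynomialAt_eq_one_of_localEulerFactor_eq_one X w h)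

end LocalFactor

/-! ## §2 CM by a maximal order: good primes are unramified in `K`; bad primes stay bad over `K` -/

section CMLocal

variable (W : WeierstrassCurve ℚ) [W.IsElliptic] {K : Type} [Field K] [NumberField K]

/-- **A prime of good reduction of a CM curve `E/ℚ` (maximal order) is unramified in the CM field `K`**
(Silverman II Ex. 2.31 (a): "If `𝔓` ramifies in `L′`, prove that `E` has bad reduction at `𝔓`"): at a place of
ramification index `2` the tree's ramified leaf `Deuring_localEulerFactor_ramified` gives `L_p(E)⁻¹ = 1`, i.e. additive
reduction (§1); and `p ∣ d_K` produces such a place (Dedekind, `exists_place_ramificationIdx_ne_one_of_dvd_discr`,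
with `e ∈ {1, 2}` in a quadratic field). [cite: SilvermanATAEC1994, Ch. II Exercise 2.31 (a) (p. 179)] -/
theorem not_dvd_discr_of_hasGoodReductionAtPrime (hj : W.j ∈ maximalCMJInvariants) (hK : IsCMFieldOfJ K W.j)
    {p : ℕ} [hp : Fact p.Prime] (hgood : W.HasGoodReductionAtPrime p) : ¬ (p : ℤ) ∣ NumberField.discr K := by
  intro hdvd
  obtain ⟨v, hpv⟩ : ∃ v : HeightOneSpectrum (𝓞 ℚ), (primesEquiv v : ℕ) = p :=
    ⟨primesEquiv.symm ⟨p, hp.out⟩, by rw [Equiv.apply_symm_apply]⟩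
  subst hpv
  obtain ⟨w, hwv, hne⟩ := exists_place_ramificationIdx_ne_one_of_dvd_discr K v hdvd
  have hw : w.under (𝓞 ℚ) = v := HeightOneSpectrum.ext hwv
  -- `e(w|v) ∈ {1, 2}` in the quadratic field, so `e = 2`
  have he : w.asIdeal.ramificationIdx (𝓞 ℚ) = 2 := by
    rcases placesOver_trichotomy_of_finrank_eq_two K hK.1 v with
      ⟨w₁, w₂, -, -, hall⟩ | ⟨w₀, hS, he1, -⟩ | ⟨w₀, hS, he2, -⟩
    · exact absurd (hall w hw).1 hne
    · have : w = w₀ := by simpa using (show w ∈ ({w₀} : Set _) by rw [← hS]; exact hw)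
      subst this; exact absurd he1 hne
    · have : w = w₀ := by simpa using (show w ∈ ({w₀} : Set _) by rw [← hS]; exact hw)
      subst this; exact he2
  have hfac := (Deuring_localEulerFactor_ramified W hj K hK w he).2
  rw [hw] at hfac
  have hbad := not_hasGoodReductionAt_of_localEulerFactor_eq_one W v hfac
  exact hbad ((hasGoodReductionAtPrime_iff_hasGoodReductionAt_ringOfIntegers v W).mp hgood)

/-- `E` has additive reduction at a bad prime when it has CM (no multiplicative primes: `j(E) ∈ ℤ`).
[cite: SilvermanATAEC1994, Thm. II.6.4 and proof of Thm. II.10.5 (p. 172)] -/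
theorem hasAdditiveReductionAt_of_hasCM_of_bad (hCM : W.HasCM) (v : HeightOneSpectrum (𝓞 ℚ))
    (hbad : ¬ W.HasGoodReductionAt v) : W.HasAdditiveReductionAt v := by
  haveI := Fact.mk (primesEquiv v).2
  rcases W.hasGoodReductionAt_or_hasMultiplicativeReductionAt_or_hasAdditiveReductionAt v with hg | hm | ha
  · exact absurd hg hbad
  · exact absurd ((W.hasMultiplicativeReductionAtPrime_iff_hasMultiplicativeReductionAt_ringOfIntegers v).mpr hm)
      (W.not_hasMultiplicativeReductionAtPrime_of_hasCM hCM _)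
  · exact ha

/-- **A bad prime of a CM curve `E/ℚ` (maximal order) stays bad at EVERY place of the CM field above it**
(Silverman II Thm. 9.2 (b) with Thm. 10.5: `ψ` ramified ⟺ bad; here WITHOUT the character). From the tree's proved
prime-by-prime Deuring identity `∏_{w ∣ p} L_w(E_K)⁻¹ = (L_p(E)⁻¹)²` (`Deuring_localEulerFactor_baseChange_cmField_holds`)
with `L_p(E)⁻¹ = 1` (additive): a single place has `L_w⁻¹ = 1`; two places `w₁ ≠ w₂` (split `p`, both of norm `p`)
have `(1/L_{w₁}(T))(1/L_{w₂}(T)) = 1`, so `L_{w₁}(T) L_{w₂}(T) = 1` in `ℤ[T]` and both are `1`; `L_w(T) = 1` is additive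
reduction (§1). [cite: SilvermanATAEC1994, Ch. II Thm. 9.2 (b) and Thm. 10.5 (p. 165, 171)]
[cite: SilvermanAEC2009, VII.5 Prop. 5.1 and App. C §16] -/
theorem not_hasGoodReductionAt_baseChange_of_bad (hj : W.j ∈ maximalCMJInvariants) (hK : IsCMFieldOfJ K W.j)
    {p : ℕ} [hp : Fact p.Prime] (hbad : ¬ W.HasGoodReductionAtPrime p) (w : HeightOneSpectrum (𝓞 K))
    (hw : ((p : ℕ) : 𝓞 K) ∈ w.asIdeal) : ¬ (W.baseChange K).HasGoodReductionAt w := by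
  set v : HeightOneSpectrum (𝓞 ℚ) := w.under (𝓞 ℚ) with hv
  have hgen : natGenerator v = p := natGenerator_under_eq_of_natCast_mem w hp.out hw
  have hpv : (primesEquiv v : ℕ) = p := hgen
  -- `L_v(E)⁻¹ = 1`
  have hbadv : ¬ W.HasGoodReductionAt v := by
    intro h
    have h' := (hasGoodReductionAtPrime_iff_hasGoodReductionAt_ringOfIntegers v W).mpr h
    obtain ⟨q, hq⟩ : ∃ q : Nat.Primes, primesEquiv v = q := ⟨_, rfl⟩
    have hqp : (q : ℕ) = p := by rw [← hq]; exact hpv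
    subst hqp
    rw [hq] at h'
    exact hbad h'
  have hadd : W.HasAdditiveReductionAt v :=
    hasAdditiveReductionAt_of_hasCM_of_bad W (hasCM_of_j_mem_cmJInvariants W (maximalCMJInvariants_subset_cmJInvariants hj))
      v hbadv
  have hone : (W.baseChange (v.adicCompletion ℚ)).localEulerFactor (v.adicCompletionIntegers ℚ) = 1 := by
    rw [W.localEulerFactor_baseChange_adicCompletion v, localPolynomialAt_of_hasAdditiveReductionAt hadd,
      Polynomial.coe_one]
    have h1 := PowerSeries.mul_invOfUnit (1 : PowerSeries ℤ) 1 (by simp)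
    rw [one_mul] at h1
    rw [h1, map_one]
  -- the Deuring identity at `v`
  have hD := Deuring_localEulerFactor_baseChange_cmField_holds W hj K hK v
  rw [hone, one_pow] at hD
  rcases placesOver_trichotomy_of_finrank_eq_two K hK.1 v with
    ⟨w₁, w₂, hne, hS, hall⟩ | ⟨w₀, hS, -, -⟩ | ⟨w₀, hS, -, -⟩
  · -- split: two places of norm `p`
    rw [hS, finprod_mem_pair hne] at hD
    have hN : ∀ {w' : HeightOneSpectrum (𝓞 K)}, w'.under (𝓞 ℚ) = v → w'.residueCard = p := by
      intro w' hw'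
      have hf := (hall w' hw').2
      change Ideal.absNorm w'.asIdeal = p
      rw [absNorm_asIdeal_eq_natGenerator_pow, hw', hf, pow_one, hgen]
    have hm₁ : w₁.under (𝓞 ℚ) = v := by
      have : w₁ ∈ ({w₁, w₂} : Set (HeightOneSpectrum (𝓞 K))) := Set.mem_insert _ _
      rw [← hS] at this; exact this
    have hm₂ : w₂.under (𝓞 ℚ) = v := by
      have : w₂ ∈ ({w₁, w₂} : Set (HeightOneSpectrum (𝓞 K))) := Set.mem_insert_of_mem _ rfl
      rw [← hS] at this; exact this
    rw [(W.baseChange K).localEulerFactor_baseChange_adicCompletion w₁,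
      (W.baseChange K).localEulerFactor_baseChange_adicCompletion w₂, hN hm₁, hN hm₂, ← map_mul, ← map_one
      (ArithmeticFunction.ofPowerSeries (R := ℤ) p)] at hD
    have hps := ofPowerSeries_injective hp.out.one_lt hD
    -- `(1/L₁)(1/L₂) = 1 ⇒ L₁ L₂ = 1`
    set P₁ : ℤ[X] := (W.baseChange K).localPolynomialAt w₁ with hP₁
    set P₂ : ℤ[X] := (W.baseChange K).localPolynomialAt w₂ with hP₂
    have hc₁ : PowerSeries.constantCoeff (P₁ : PowerSeries ℤ) = ((1 : ℤˣ) : ℤ) := by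
      rw [← PowerSeries.coeff_zero_eq_constantCoeff_apply, Polynomial.coeff_coe,
        (W.baseChange K).coeff_zero_localPolynomialAt w₁, Units.val_one]
    have hc₂ : PowerSeries.constantCoeff (P₂ : PowerSeries ℤ) = ((1 : ℤˣ) : ℤ) := by
      rw [← PowerSeries.coeff_zero_eq_constantCoeff_apply, Polynomial.coeff_coe,
        (W.baseChange K).coeff_zero_localPolynomialAt w₂, Units.val_one]
    have hprod : ((P₁ * P₂ : ℤ[X]) : PowerSeries ℤ) = 1 := by
      have e1 := PowerSeries.mul_invOfUnit (P₁ : PowerSeries ℤ) 1 hc₁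
      have e2 := PowerSeries.mul_invOfUnit (P₂ : PowerSeries ℤ) 1 hc₂
      rw [Polynomial.coe_mul]
      calc (P₁ : PowerSeries ℤ) * (P₂ : PowerSeries ℤ)
          = ((P₁ : PowerSeries ℤ) * PowerSeries.invOfUnit (P₁ : PowerSeries ℤ) 1) *
              ((P₂ : PowerSeries ℤ) * PowerSeries.invOfUnit (P₂ : PowerSeries ℤ) 1) := by
            rw [mul_mul_mul_comm, hps, mul_one]
        _ = 1 := by rw [e1, e2, mul_one]
    have hprod' : P₁ * P₂ = 1 := Polynomial.coe_injective ℤ (hprod.trans Polynomial.coe_one.symm)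
    have hP₁1 : P₁ = 1 := polynomial_eq_one_of_mul_eq_one ((W.baseChange K).coeff_zero_localPolynomialAt w₁) hprod'
    have hP₂1 : P₂ = 1 :=
      polynomial_eq_one_of_mul_eq_one ((W.baseChange K).coeff_zero_localPolynomialAt w₂) (by rw [mul_comm]; exact hprod')
    have hwS : w ∈ ({w₁, w₂} : Set (HeightOneSpectrum (𝓞 K))) := by rw [← hS]; exact hv.symm
    rcases hwS with rfl | rfl
    · exact not_hasGoodReductionAt_of_localPolynomialAt_eq_one _ _ hP₁1
    · exact not_hasGoodReductionAt_of_localPolynomialAt_eq_one _ _ hP₂1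
  all_goals
    -- a single place `w = w₀` above `v`
    have hw0 : w = w₀ := by simpa using (show w ∈ ({w₀} : Set _) by rw [← hS]; exact hv.symm)
    subst hw0
    rw [hS, finprod_mem_singleton] at hD
    exact not_hasGoodReductionAt_of_localEulerFactor_eq_one _ _ hD

end CMLocal

end Summit.BirchSwinnertonDyer.BirchSwinnertonDyer.Theorems.BiquadraticEisensteinDescentDeuringOfCore

end
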